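import Mathlib
import Literature.Computability.AlgebraicComplexity.StandardFamilies
import Summits.ValiantsHypothesis.ValiantsHypothesis.Theorems.ChowBorderDepth3BStableWitnessBoundRyserLocal
import Summits.ValiantsHypothesis.ValiantsHypothesis.Theorems.ChowBorderDepth3ChowBorderBoundGradedOfCrux

/-!
# `ChowBorderBound` is FALSE without its bound on the number `r` of products
# (Ryser's formula; crux stmt-ValiantsHypothesis-5936, negative side)

Support file (`--supports stmt-ValiantsHypothesis-5936`) of route `ValiantsHypothesis/ChowBorderDepth3`.
Companion of `…ChowBorderBoundNegativeDBound` (the bound on `D` is necessary, Kumar 2020): here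
the bound on `r` is necessary.  Ryser's formula, read as a local border expression
(`exists_local_ryser_perPoly`: `Σ_{S ⊆ [n]} (-1)^(n-|S|) Π_{i<n} (1 + ε Σ_{l∈S} x_il) = ε^n per_n`),
is a border `σ_r(Ch_D)`-expression of the padded permanent with `r = 2^n` products of only
`D = n` affine forms (`exists_border_ryser`), and `D = n ≤ (n+2)^(c⌊√n⌋+c)` for every `c ≥ 1`;
so the crux with the hypothesis `r ≤ (n+2)^(c⌊√n⌋+c)` deleted is false
(`chowBorderBound_false_without_rBound`).  With the flattening rung
(`…PaddedFlatteningRung`: at `D ≤ n^(5/4)` NO `r ≤ (n+2)^(c⌊√n⌋+c)` works) this brackets the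
unpadded corner `D = n`: `r` must be `n^(ω(√n))`, and `r = 2^n` suffices.

References: H. J. Ryser, *Combinatorial Mathematics*, Carus Monograph 14 (1963), Ch. 2 §4;
J. M. Landsberg, *Geometry and complexity theory*, CUP 2017, §7.2, Cor. 7.5.3.3.
-/

noncomputable section

-- `Summit.ValiantsHypothesis.ValiantsHypothesis.…` is the tree's mandated single-conjunct layout
-- (Sub = Summit), so the duplicated namespace component is intended.
set_option linter.dupNamespace false

namespace Summit.ValiantsHypothesis.ValiantsHypothesis.Theorems.ChowBorderBound.NegativeRBound

open MvPolynomial Literature.Computability.AlgebraicComplexity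
open scoped Polynomial

/-- **Ryser's formula as a border `σ_(2^n)(Ch_n)`-expression of the padded permanent**: `2^n`
products of `n` affine forms over `ℂ[ε]` summing to `ε^q per_n + ε^(q+1) G` (`n ≥ 1`).
[cite: Ryser1963, Ch. 2 §4] -/
theorem exists_border_ryser (n : ℕ) (hn : 1 ≤ n) :
    ∃ (q : ℕ) (ℓ : Fin (2 ^ n) → Fin n → MvPolynomial (Fin n × Fin n) ℂ[X])
      (G : MvPolynomial (Fin n × Fin n) ℂ[X]),
      (∀ i j, (ℓ i j).totalDegree ≤ 1) ∧
      ∑ i, ∏ j, ℓ i j = C (Polynomial.X ^ q) * MvPolynomial.map Polynomial.C (perPoly (Fin n) ℂ) +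
        C (Polynomial.X ^ (q + 1)) * G := by
  classical
  obtain ⟨q, a, m, G, -, hsum⟩ :=
    Summit.ValiantsHypothesis.ValiantsHypothesis.Theorems.exists_local_ryser_perPoly n
  -- each local summand `a_i Π_j (1 + m_ij)` is a product of `n` affine forms
  have hrow : ∀ i : Fin (2 ^ n), ∃ ℓ : Fin n → MvPolynomial (Fin n × Fin n) ℂ[X],
      (∀ j, (ℓ j).totalDegree ≤ 1) ∧
        ∏ j, ℓ j = C (a i) * ∏ j, (1 + ∑ v, C (m i j v) * X v) := by
    intro i
    refine GradedOfCrux.exists_affine_prod_eq hn (a i) (fun j => ∑ v, C (m i j v) * X v) ?_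
    intro j
    refine (totalDegree_finsetSum _ _).trans (Finset.sup_le fun v _ => ?_)
    refine (totalDegree_mul _ _).trans ?_
    rw [totalDegree_C, zero_add]
    exact (totalDegree_X _).le
  choose ℓ hℓ hprod using hrow
  refine ⟨q, ℓ, G, hℓ, ?_⟩
  rw [← hsum]
  exact Finset.sum_congr rfl fun i _ => hprod i

/-- **`ChowBorderBound` is false without its bound on `r`** (registered sub-goal
`chowBorderBound_false_without_rBound` of stmt-ValiantsHypothesis-5936): deleting the hypothesis
`r ≤ (n+2)^(c⌊√n⌋+c)` from the crux makes it false — at `c = 1`, `D = n ≤ (n+2)^(⌊√n⌋+1)` and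
Ryser's `r = 2^n` products exist for every `n ≥ 1`.  Any proof of the crux must therefore use
the bound on the number of products. [cite: Ryser1963, Ch. 2 §4] -/
theorem chowBorderBound_false_without_rBound :
    ¬ ∀ c : ℕ, ∃ n₀ : ℕ, ∀ n ≥ n₀, ∀ r D : ℕ, D ≤ (n + 2) ^ (c * Nat.sqrt n + c) →
      ¬ ∃ (q : ℕ) (ℓ : Fin r → Fin D → MvPolynomial (Fin n × Fin n) (Polynomial ℂ))
          (G : MvPolynomial (Fin n × Fin n) (Polynomial ℂ)),
          (∀ i j, (ℓ i j).totalDegree ≤ 1) ∧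
          (∑ i, ∏ j, ℓ i j) =
            MvPolynomial.C (Polynomial.X ^ q) *
                MvPolynomial.map Polynomial.C
                  (Literature.Computability.AlgebraicComplexity.perPoly (Fin n) ℂ) +
              MvPolynomial.C (Polynomial.X ^ (q + 1)) * G := by
  intro h
  obtain ⟨n₀, h₀⟩ := h 1
  obtain ⟨q, ℓ, G, hℓ, hsum⟩ := exists_border_ryser (max n₀ 1) (le_max_right _ _)
  refine h₀ (max n₀ 1) (le_max_left _ _) (2 ^ max n₀ 1) (max n₀ 1) ?_ ⟨q, ℓ, G, hℓ, hsum⟩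
  calc max n₀ 1 ≤ max n₀ 1 + 2 := by omega
    _ ≤ (max n₀ 1 + 2) ^ (1 * Nat.sqrt (max n₀ 1) + 1) := Nat.le_self_pow (by omega) _

end Summit.ValiantsHypothesis.ValiantsHypothesis.Theorems.ChowBorderBound.NegativeRBound

end
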